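import Mathlib
import Summits.NavierStokesRegularity.NavierStokesRegularity.Theorems.PerpetualPumpCircuitPumpTruncatedFlow
import HarnessLib

/-!
# `WakeRatchet.TailRatchet` (stmt-NavierStokesRegularity-21808): the TRUNCATED inviscid dyadic lattice —
# energy conservation, a priori bound, and the global flow with continuous dependence

Support file for the crux `TailRatchet` (route `WakeRatchet`; MODEL lattice ODEs of Tao 2016 §4 —
nothing here is a statement about the Navier–Stokes equations).  Third brick of the reduction of the
blocking construction `DyadicScalarFronts` to the shape in which `PerpetualPump.CircuitPump` was proved:
after `…LatticePeriod.lean` (unrolling, admissibility) and `…TruncationLimit.lean` (truncation limit),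
what is left is a fixed point of (truncated dyadic flow) ∘ (scaled shift) on a box of truncated states.
This file supplies the FLOW (dyadic analogue of stub C1 `stub_truncatedFlow` of
`Cruxes/CircuitPump/Lines/singular-clock-gspt`), with its a priori bound discharged — the inviscid
dyadic chain conserves the truncated energy exactly:

* `truncated_energy_conserved` — for the `K`-truncated lattice `Ż_n = Λ^{n-1}Z_{n-1}² − Λ^n Z_n Z_{n+1}`
  (`|n| ≤ K`, shells `|n| > K` frozen at `0`) on `[0, T']`, the truncated energy `Σ_{|n|≤K} Z_n²`
  (indexed by `j < 2K+1`, `n = j − K`) is constant in time (the fluxes `Λ^n Z_n² Z_{n+1}` telescope and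
  vanish at both ends of the window);
* `truncated_sq_le_energy` — hence `Z_n(t)² ≤ Σ_{|m|≤K} Z_m(0)²` for every shell and time;
* `truncated_contDiff` — the truncated field on `E = (Icc (-K) K → ℝ)` is `C¹` (polynomial);
* `truncated_flow` — for data vanishing off the window with truncated energy `≤ R₀²`, a flow map on
  `[0, Tmax]` solving the truncated system from every datum, jointly continuous in (datum, time)
  coordinatewise (transport to `E` + the tree's generic `PerpetualPumpCircuitPump.truncatedFlow_flow`:
  bump cut-off, global Lipschitz flow, continuation principle, uniqueness).

HONEST FRAMING: elementary facts about a finite-dimensional MODEL ODE; no registered stub of the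
skeleton is closed, no summit statement is touched.
-/

noncomputable section

set_option linter.dupNamespace false

namespace Summit.NavierStokesRegularity.NavierStokesRegularity.Theorems

namespace WakeRatchetLatticePeriod

open Set Filter Topology Finset
open PerpetualPumpCircuitPump (truncatedFlow_flow)

/-- **Energy conservation of the `K`-truncated inviscid dyadic lattice.**  If the shells `|n| ≤ K` solve
`Ż_n = Λ^{n-1} Z_{n-1}² − Λ^n Z_n Z_{n+1}` on `[0, T']` and the shells `|n| > K` are frozen at `0`, then
the truncated energy `Σ_{|n| ≤ K} Z_n²` (written over `j < 2K+1`, `n = j − K`) is constant: the flux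
terms `Λ^n Z_n² Z_{n+1}` telescope and vanish at both ends of the window.
[cite: Tao2016AveragedNS, §1.2 (energy identity of the dyadic model); elementary] -/
theorem truncated_energy_conserved {L : ℝ} {K : ℕ} {T' : ℝ} {Z : ℤ → ℝ → ℝ}
    (hD : ∀ n : ℤ, |n| ≤ (K : ℤ) → ∀ t ∈ Icc (0 : ℝ) T', HasDerivWithinAt (Z n)
      (L ^ (n - 1) * Z (n - 1) t ^ 2 - L ^ n * Z n t * Z (n + 1) t) (Icc (0 : ℝ) T') t)
    (hzero : ∀ n : ℤ, (K : ℤ) < |n| → ∀ t ∈ Icc (0 : ℝ) T', Z n t = 0) :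
    ∀ t ∈ Icc (0 : ℝ) T',
      ∑ j ∈ range (2 * K + 1), Z ((j : ℤ) - K) t ^ 2 = ∑ j ∈ range (2 * K + 1), Z ((j : ℤ) - K) 0 ^ 2 := by
  -- the energy and its derivative within `[0, T']`
  set E : ℝ → ℝ := fun t => ∑ j ∈ range (2 * K + 1), Z ((j : ℤ) - K) t ^ 2 with hE
  have hmemK : ∀ j ∈ range (2 * K + 1), |((j : ℤ) - K)| ≤ (K : ℤ) := by
    intro j hj
    rw [Finset.mem_range] at hj
    rw [abs_le]; constructor <;> omega
  have hderiv : ∀ t ∈ Icc (0 : ℝ) T', HasDerivWithinAt E 0 (Icc (0 : ℝ) T') t := by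
    intro t ht
    -- flux term `φ n = Λ^n Z_n² Z_{n+1}`
    set φ : ℤ → ℝ := fun n => L ^ n * Z n t ^ 2 * Z (n + 1) t with hφ
    have hsum : HasDerivWithinAt E
        (∑ j ∈ range (2 * K + 1), 2 * (φ (((j : ℤ) - K) - 1) - φ ((j : ℤ) - K))) (Icc (0 : ℝ) T') t := by
      have := HasDerivWithinAt.sum (u := range (2 * K + 1))
        (A := fun j s => Z ((j : ℤ) - K) s ^ 2)
        (A' := fun j => 2 * (φ (((j : ℤ) - K) - 1) - φ ((j : ℤ) - K))) (x := t) (s := Icc (0 : ℝ) T')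
        (fun j hj => by
          have h := (hD _ (hmemK j hj) t ht).pow 2
          refine h.congr_deriv ?_
          simp only [hφ]
          push_cast
          ring_nf)
      simpa only [hE, Finset.sum_fn] using this
    have htel : ∑ j ∈ range (2 * K + 1), 2 * (φ (((j : ℤ) - K) - 1) - φ ((j : ℤ) - K)) = 0 := by
      have h1 : ∑ j ∈ range (2 * K + 1), 2 * (φ (((j : ℤ) - K) - 1) - φ ((j : ℤ) - K))
          = -(2 * ∑ j ∈ range (2 * K + 1), (φ (((j + 1 : ℕ) : ℤ) - K - 1) - φ ((j : ℤ) - K - 1))) := by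
        rw [Finset.mul_sum, ← Finset.sum_neg_distrib]
        refine Finset.sum_congr rfl fun j _ => ?_
        push_cast
        ring_nf
      rw [h1, Finset.sum_range_sub (fun j => φ ((j : ℤ) - K - 1)), neg_eq_zero]
      have htop : φ (((2 * K + 1 : ℕ) : ℤ) - K - 1) = 0 := by
        simp only [hφ]
        rw [hzero (((2 * K + 1 : ℕ) : ℤ) - K - 1 + 1) (by push_cast; rw [abs_of_nonneg] <;> omega) t ht]
        ring
      have hbot : φ (((0 : ℕ) : ℤ) - K - 1) = 0 := by
        simp only [hφ]
        rw [hzero (((0 : ℕ) : ℤ) - K - 1) (by push_cast; rw [abs_of_nonpos] <;> omega) t ht]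
        ring
      rw [htop, hbot]; ring
    rw [htel] at hsum
    exact hsum
  have hcont : ContinuousOn E (Icc (0 : ℝ) T') := fun t ht => (hderiv t ht).continuousWithinAt
  intro t ht
  refine constant_of_has_deriv_right_zero hcont (fun x hx => ?_) t ht
  exact (hderiv x ⟨hx.1, hx.2.le⟩).mono_of_mem_nhdsWithin
    (mem_of_superset (Icc_mem_nhdsGE hx.2) (Icc_subset_Icc_left hx.1))

/-- **A priori bound of the truncated dyadic lattice**: every shell is bounded at every time by the
square root of the (conserved) initial truncated energy; frozen shells are `0`.
[cite: Tao2016AveragedNS, §1.2; elementary] -/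
theorem truncated_sq_le_energy {L : ℝ} {K : ℕ} {T' : ℝ} {Z : ℤ → ℝ → ℝ}
    (hD : ∀ n : ℤ, |n| ≤ (K : ℤ) → ∀ t ∈ Icc (0 : ℝ) T', HasDerivWithinAt (Z n)
      (L ^ (n - 1) * Z (n - 1) t ^ 2 - L ^ n * Z n t * Z (n + 1) t) (Icc (0 : ℝ) T') t)
    (hzero : ∀ n : ℤ, (K : ℤ) < |n| → ∀ t ∈ Icc (0 : ℝ) T', Z n t = 0) (n : ℤ) :
    ∀ t ∈ Icc (0 : ℝ) T', Z n t ^ 2 ≤ ∑ j ∈ range (2 * K + 1), Z ((j : ℤ) - K) 0 ^ 2 := by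
  intro t ht
  by_cases hn : |n| ≤ (K : ℤ)
  · rw [← truncated_energy_conserved hD hzero t ht]
    have hj : (n + K).toNat ∈ range (2 * K + 1) := by
      rw [Finset.mem_range]; rw [abs_le] at hn; omega
    have hjn : (((n + K).toNat : ℕ) : ℤ) - K = n := by
      rw [abs_le] at hn; rw [Int.toNat_of_nonneg (by omega)]; ring
    have := Finset.single_le_sum (f := fun j : ℕ => Z ((j : ℤ) - K) t ^ 2)
      (fun (j : ℕ) _ => sq_nonneg (Z ((j : ℤ) - K) t)) hj
    simpa only [hjn] using this
  · rw [hzero n (not_le.1 hn) t ht]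
    simpa only [ne_eq, OfNat.ofNat_ne_zero, not_false_eq_true, zero_pow] using
      Finset.sum_nonneg fun (j : ℕ) (_ : j ∈ range (2 * K + 1)) => sq_nonneg (Z ((j : ℤ) - K) 0)

/-- The truncated dyadic vector field on `E = (Icc (-K) K → ℝ)` (shells outside the window read as `0`)
is of class `C¹`: it is polynomial in the coordinates. [elementary] -/
theorem truncated_contDiff (L : ℝ) (K : ℕ) :
    ContDiff ℝ 1 (fun (y : ↥(Set.Icc (-(K : ℤ)) (K : ℤ)) → ℝ) (k : ↥(Set.Icc (-(K : ℤ)) (K : ℤ))) =>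
      L ^ ((k : ℤ) - 1) *
          (if h : |(k : ℤ) - 1| ≤ (K : ℤ) then y ⟨(k : ℤ) - 1, abs_le.1 h⟩ else 0) ^ 2 -
        L ^ (k : ℤ) * (if h : |(k : ℤ)| ≤ (K : ℤ) then y ⟨(k : ℤ), abs_le.1 h⟩ else 0) *
          (if h : |(k : ℤ) + 1| ≤ (K : ℤ) then y ⟨(k : ℤ) + 1, abs_le.1 h⟩ else 0)) := by
  have hc : ∀ n' : ℤ, ContDiff ℝ 1 (fun y : ↥(Set.Icc (-(K : ℤ)) (K : ℤ)) → ℝ =>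
      if h : |n'| ≤ (K : ℤ) then y ⟨n', abs_le.1 h⟩ else 0) := by
    intro n'
    by_cases h : |n'| ≤ (K : ℤ)
    · simp only [dif_pos h]
      exact contDiff_apply ℝ ℝ (⟨n', abs_le.1 h⟩ : ↥(Set.Icc (-(K : ℤ)) (K : ℤ)))
    · simp only [dif_neg h]
      exact contDiff_const
  refine contDiff_pi.2 fun k => ?_
  exact (contDiff_const.mul ((hc _).pow 2)).sub ((contDiff_const.mul (hc _)).mul (hc _))

/-- **Global flow of the `K`-truncated inviscid dyadic lattice with continuous dependence (dyadic
analogue of `PerpetualPumpCircuitPump.stub_truncatedFlow`, a priori bound DISCHARGED by energy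
conservation).**  For every set `S` of data vanishing off `|n| ≤ K` with bounded truncated energy
(`Σ_{|n|≤K} x_n² ≤ R₀²`) and every `Tmax > 0` there is a flow map `Φ : datum → time → state` solving the
truncated system `Ż_n = Λ^{n-1}Z_{n-1}² − Λ^n Z_n Z_{n+1}` (`|n| ≤ K`; frozen at `0` outside) on
`[0, Tmax]` from every `x ∈ S`, jointly continuous in `(x, t) ∈ S × [0, Tmax]` coordinatewise.  Proof:
transport to `E = (Icc (-K) K → ℝ)`, where the system is a `C¹` ODE (`truncated_contDiff`); every
solution keeps `|Z_n(t)| ≤ |R₀|` (`truncated_sq_le_energy`), so the tree's generic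
`PerpetualPumpCircuitPump.truncatedFlow_flow` (bump cut-off, global Lipschitz flow, continuation,
uniqueness) applies. [folklore; cite: Tao2016AveragedNS, §1.2] -/
theorem truncated_flow (L : ℝ) (K : ℕ) {Tmax : ℝ} (R₀ : ℝ) (S : Set (ℤ → ℝ)) (hTmax : 0 < Tmax)
    (hS : ∀ x ∈ S, ∀ n : ℤ, (K : ℤ) < |n| → x n = 0)
    (hR : ∀ x ∈ S, ∑ j ∈ range (2 * K + 1), x ((j : ℤ) - K) ^ 2 ≤ R₀ ^ 2) :
    ∃ Φ : (ℤ → ℝ) → ℝ → (ℤ → ℝ),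
      (∀ x ∈ S,
        (∀ n : ℤ, Φ x 0 n = x n) ∧
        (∀ n : ℤ, (K : ℤ) < |n| → ∀ t ∈ Set.Icc (0 : ℝ) Tmax, Φ x t n = 0) ∧
        (∀ n : ℤ, |n| ≤ (K : ℤ) → ∀ t ∈ Set.Icc (0 : ℝ) Tmax,
          HasDerivWithinAt (fun s => Φ x s n)
            (L ^ (n - 1) * Φ x t (n - 1) ^ 2 - L ^ n * Φ x t n * Φ x t (n + 1))
            (Set.Icc (0 : ℝ) Tmax) t)) ∧
      (∀ n : ℤ, ContinuousOn (fun p : (ℤ → ℝ) × ℝ => Φ p.1 p.2 n) (S ×ˢ Set.Icc (0 : ℝ) Tmax)) := by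
  have hR0 : 0 ≤ |R₀| := abs_nonneg _
  have hflow := truncatedFlow_flow (truncated_contDiff L K)
    (A := (fun (x : ℤ → ℝ) (k : ↥(Set.Icc (-(K : ℤ)) (K : ℤ))) => x k) '' S) (R := |R₀|) hTmax
  refine (hflow ?_).elim fun Ψ hΨ' => ?_
  · -- the a priori bound, transported to `E`: energy conservation
    rintro _ ⟨x, hx, rfl⟩ s hs hsT β hβ0 hβ t ht
    set Z : ℤ → ℝ → ℝ :=
      fun n τ => if h : |n| ≤ (K : ℤ) then β τ ⟨n, abs_le.1 h⟩ else 0 with hZ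
    have h1 : ∀ n : ℤ, Z n 0 = x n := by
      intro n
      by_cases hn : |n| ≤ (K : ℤ)
      · simp only [hZ, dif_pos hn, hβ0]
      · simp only [hZ, dif_neg hn]
        exact (hS x hx n (not_le.1 hn)).symm
    have h2 : ∀ n : ℤ, (K : ℤ) < |n| → ∀ τ ∈ Set.Icc (0 : ℝ) s, Z n τ = 0 :=
      fun n hn τ _ => by simp only [hZ, dif_neg (not_le.2 hn)]
    have h3 : ∀ n : ℤ, |n| ≤ (K : ℤ) → ∀ τ ∈ Set.Icc (0 : ℝ) s,
        HasDerivWithinAt (Z n) (L ^ (n - 1) * Z (n - 1) τ ^ 2 - L ^ n * Z n τ * Z (n + 1) τ)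
          (Set.Icc (0 : ℝ) s) τ := by
      intro n hn τ hτ
      have hd := hasDerivWithinAt_pi.1 (hβ τ hτ) ⟨n, abs_le.1 hn⟩
      simp only [hZ, dif_pos hn] at hd ⊢
      exact hd
    rw [pi_norm_le_iff_of_nonneg hR0]
    intro k
    have hk : |(k : ℤ)| ≤ (K : ℤ) := abs_le.2 (Set.mem_Icc.1 k.2)
    have hsq := truncated_sq_le_energy h3 h2 (k : ℤ) t ht
    have hZk : Z k t = β t k := by simp only [hZ, dif_pos hk]
    rw [hZk] at hsq
    simp only [h1] at hsq
    rw [Real.norm_eq_abs]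
    exact sq_le_sq.1 (hsq.trans (hR x hx))
  · -- the flow, transported back to the lattice
    obtain ⟨hΨc, hΨ⟩ := hΨ'
    refine ⟨fun x t n => if h : |n| ≤ (K : ℤ) then
        Ψ (fun (k : ↥(Set.Icc (-(K : ℤ)) (K : ℤ))) => x k) t ⟨n, abs_le.1 h⟩ else 0,
      fun x hx => ?_, fun n => ?_⟩
    · obtain ⟨h0, hd⟩ := hΨ _ ⟨x, hx, rfl⟩
      refine ⟨fun n => ?_, fun n hn t _ => by simp only [dif_neg (not_le.2 hn)], fun n hn t ht => ?_⟩
      · by_cases hn : |n| ≤ (K : ℤ)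
        · simp only [dif_pos hn, h0]
        · simp only [dif_neg hn]
          exact (hS x hx n (not_le.1 hn)).symm
      · have h1 := hasDerivWithinAt_pi.1 (hd t ht) ⟨n, abs_le.1 hn⟩
        simp only [dif_pos hn] at h1 ⊢
        exact h1
    · by_cases hn : |n| ≤ (K : ℤ)
      · simp only [dif_pos hn]
        have hr : Continuous (fun p : (ℤ → ℝ) × ℝ =>
            ((fun (k : ↥(Set.Icc (-(K : ℤ)) (K : ℤ))) => p.1 k), p.2)) := by
          refine (continuous_pi fun k => ?_).prodMk continuous_snd
          exact (continuous_apply (k : ℤ)).comp continuous_fst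
        exact ((continuous_apply _).comp (hΨc.comp hr)).continuousOn
      · simpa only [dif_neg hn] using continuousOn_const

end WakeRatchetLatticePeriod

end Summit.NavierStokesRegularity.NavierStokesRegularity.Theorems

end
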